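import Mathlib

/-!
# `MatrixDescartes` census — rank-one `(2,3)₁`: THE LONE-LETTER LAW, part 1 (the FENCE):
# the critical directions on each side of the pivot letter are governed by ONE quintic whose real roots are fenced by the
# roots of the three quadratic brackets — exactly one critical point of the weight-free function per window

HONEST FRAMING.  Object-search cell `pub-symmetroid`, seat `val-sym-mdr-p1` (generation 22); helper file `--supports` the crux item
stmt-ValiantsHypothesis-18050 (`Theses.LacunarySymmetroid.MatrixDescartes`, OPEN, on HOLD) with NO closure claim.  Companion of
`…PivotRankOneCriticalWindows` (the CRITICAL WINDOWS LAW) and `…PivotRankOneCriticalWindowsThree` (the `K = 3` weight elimination: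
`wⱼ^q w₀^p · Xᵢ^p X₀^q = wᵢ^p w₀^q · Xⱼ^q X₀^p`).  The `(2,3)₁` COUNT (`Z₊ ≤ 5`) is already in the kernel (`…PivotRankOneThree`); what this
file proves is the exact MECHANISM the seat lineage located numerically (memo PROFILE-GAUGE.md §4, 2 000/2 000): the «lone-letter law» for
three letters — and it proves it with NO slack argument (no CAD, no interval arithmetic), by a fence of sign changes.  Nothing here bears on
`MatrixDescartes` in its window, on `DoorA26` / `DoorA34`, registers / credences, or `VP ≠ VNP`.

SETTING (as in the companions).  Pivot letter `0` at `t₀`, rate `−a = d₀ − e < 0`; upper letters `i` at `tᵢ < t₀` (rate `bᵢ > 0`) and `j` at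
`tⱼ > t₀` (rate `bⱼ > 0`) — one upper letter alone on each side; direction `T`.  The cross product of the two critical covectors is
`X₀ = (T−tᵢ)(T−tⱼ)·Q₀`, `Xᵢ = (T−tⱼ)(T−t₀)·Qᵢ`, `Xⱼ = (T−t₀)(T−tᵢ)·Qⱼ` with the three QUADRATIC BRACKETS
`Q₀(T) = bⱼ(T+tᵢ)(T−tⱼ) − bᵢ(T+tⱼ)(T−tᵢ)`, `Qᵢ(T) = bⱼ(T+t₀)(tⱼ−T) − a(T+tⱼ)(T−t₀)`, `Qⱼ(T) = bᵢ(T+t₀)(T−tᵢ) + a(T+tᵢ)(T−t₀)`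
(`…CriticalWindowsThree.cross_factor`).  Taking logarithms in the weight-free equation, the critical directions with the weights
`(w₀, wᵢ, wⱼ)` are the solutions of `G(T) = κ(w)` where `G = (bᵢ−bⱼ)·log X₀ + (a+bⱼ)·log Xᵢ − (a+bᵢ)·log Xⱼ` (part 2), and
`G′ = ℓ(T) := (bᵢ−bⱼ)(Q₀′/Q₀ − 1/(T−t₀)) + (a+bⱼ)(Qᵢ′/Qᵢ − 1/(T−tᵢ)) − (a+bᵢ)(Qⱼ′/Qⱼ − 1/(T−tⱼ))` (the coefficient vector
`c = (bᵢ−bⱼ, a+bⱼ, −(a+bᵢ))` is `β × 𝟙`, so `∑ cₖ = 0` turns `∑ cₖ Xₖ′/Xₖ` into this form).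

THE POINT (all statements def-free; the quadratics are spelled out).
* §1 `fence` — a real polynomial of `natDegree ≤ 5` with three distinct roots OUTSIDE `[α, β]` and `f(α)·f(β) < 0` has no two distinct roots in
  `(α, β)` (factor theorem five times; the cofactor is a constant; sign of the product at `α` and `β`). [folklore]
* §2 the brackets: `Qᵢ` has exactly one positive root `Tₘ ∈ (t₀, tⱼ)` — the EDGE OF THE RIGHT WINDOW `(Tₘ, tⱼ)` of the critical windows law —
  with `Qᵢ′(Tₘ) < 0`; `Qⱼ` has one root `r₋ ∈ (−t₀, −tᵢ)` and one positive root `r₊ ∈ (tᵢ, t₀)` — the EDGE OF THE LEFT WINDOW `(tᵢ, r₊)` — with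
  `Qⱼ′(r₋) < 0 < Qⱼ′(r₊)`; `Q₀ < 0` on `(tᵢ, tⱼ)`. [folklore]
* §3 (sequel `…CriticalWindowsThreeQuintic`) `quintic_factor` — clearing denominators, `ℓ · Q₀QᵢQⱼ · (T−t₀)(T−tᵢ)(T−tⱼ) =: N(T)` is a polynomial of degree `≤ 6` that VANISHES AT `T = 0`:
  `N(T) = 2T·𝒩(T)` with an explicit QUINTIC `𝒩` (516 monomials, `ring`). [folklore: computation]
* §4 (same sequel) — at a root `r` of `Qₖ` the polynomial `N` collapses to `cₖ Qₖ′(r) ∏_{l≠k} Qₗ(r) ∏ₘ (r − tₘ)`, and at `T = tₘ` to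
  `−cₘ ∏ₗ Qₗ(tₘ) ∏_{m′≠m}(tₘ − t_{m′})`; with the interlacing of §2 this gives the SIGN PATTERN
  `𝒩(r₋) > 0`, `𝒩(tᵢ) < 0`, `𝒩(r₊) > 0`, `𝒩(Tₘ) < 0`, `𝒩(tⱼ) > 0` — four fenced real roots `ρ₁ < tᵢ < ρ₂ < r₊ < ρ₃ < Tₘ < ρ₄ < tⱼ`. [folklore]
* **§5 (sequel `…CriticalWindowsThreeLoneLetter`) `logDeriv_fence` (THE LONE-LETTER LAW, derivative form).**  For all positive rates and all positions `tᵢ < t₀ < tⱼ`: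
  `ℓ > 0` on `(Tₘ, T_R)`, `ℓ(T_R) = 0`, `ℓ < 0` on `(T_R, tⱼ)` for a unique `T_R` in the right window, and
  `ℓ < 0` on `(tᵢ, T_L)`, `ℓ(T_L) = 0`, `ℓ > 0` on `(T_L, r₊)` for a unique `T_L` in the left window
  (three fenced roots outside each window + the sign change across it + `natDegree 𝒩 ≤ 5`).  Consequently (part 2) the weight-free function `G` is
  strictly unimodal on each window, every level is taken at most twice per window, and for EVERY weight vector the three-letter window profile has
  at most two critical directions on each side of the pivot letter — at most one local maximum of the ψ-profile per side.
THIS FILE = §1–§2 (the generic fence lemma and the bracket facts); §3–§5 are the two sequels.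
READING.  The located «K = 3 lone-letter law» of the lineage is thereby a theorem, including the tight corner `bⱼ → a⁻`, `bᵢ → 0⁺` of the memo
(no slack is spent anywhere: the argument counts roots, it does not bound quantities).  For `K ≥ 4` the weights do not eliminate (memo §4) and
no analogue is claimed.
[folklore] Factor theorem, intermediate value theorem, sign bookkeeping, `ring`.  No definitions, no named facts.
-/

-- `Summit.ValiantsHypothesis.ValiantsHypothesis.…` repeats a component by the D-0017 layout
-- (single-conjunct summit), which the `dupNamespace` linter flags; the name is mandated.
set_option linter.dupNamespace false

open Polynomial

namespace Summit.ValiantsHypothesis.ValiantsHypothesis.Theorems.LacunarySymmetroidMatrixDescartes.Pivot.CriticalWindows.Three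

/-! ## 1. The fence lemma (real polynomials of degree at most five) -/

/-- **FACTOR STEP.**  A root `r` of a real polynomial `f` splits off: `f = (X − r)·g` with `natDegree g ≤ natDegree f − 1`. [folklore] -/
theorem exists_eq_X_sub_C_mul_of_eval_eq_zero (f : ℝ[X]) {r : ℝ} (hr : f.eval r = 0) :
    ∃ g : ℝ[X], f = (X - C r) * g ∧ g.natDegree ≤ f.natDegree - 1 := by
  refine ⟨f /ₘ (X - C r), (mul_divByMonic_eq_iff_isRoot.mpr hr).symm, ?_⟩
  rw [natDegree_divByMonic f (monic_X_sub_C r), natDegree_X_sub_C]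

/-- **OUTSIDE FACTORS HAVE ONE SIGN ACROSS THE WINDOW.**  If `ρ ∉ [α, β]` then `(α − ρ)(β − ρ) > 0`. [folklore] -/
theorem mul_sub_pos_of_outside {α β ρ : ℝ} (hαβ : α < β) (h : ρ < α ∨ β < ρ) : 0 < (α - ρ) * (β - ρ) := by
  rcases h with h | h
  · exact mul_pos (by linarith) (by linarith)
  · exact mul_pos_of_neg_of_neg (by linarith) (by linarith)

/-- **THE FENCE LEMMA.**  Let `f` be a real polynomial with `natDegree f ≤ 5`, let `ρ₁, ρ₂, ρ₃` be three distinct roots of `f` lying OUTSIDE the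
closed interval `[α, β]`, and suppose `f(α)·f(β) < 0`.  Then `f` does not have two distinct roots in `(α, β)`.  (Five roots split off by the
factor theorem leave a constant cofactor `k`; then `f(α)f(β) = k²·∏(α−ρ)(β−ρ)·∏(α−s)(β−s) ≥ 0`, the two inside factors being negative and the
three outside ones positive.) [folklore] -/
theorem fence (f : ℝ[X]) (hf : f.natDegree ≤ 5) {α β ρ₁ ρ₂ ρ₃ s₁ s₂ : ℝ} (hαβ : α < β)
    (h₁ : f.eval ρ₁ = 0) (h₂ : f.eval ρ₂ = 0) (h₃ : f.eval ρ₃ = 0)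
    (o₁ : ρ₁ < α ∨ β < ρ₁) (o₂ : ρ₂ < α ∨ β < ρ₂) (o₃ : ρ₃ < α ∨ β < ρ₃)
    (d₁₂ : ρ₁ ≠ ρ₂) (d₁₃ : ρ₁ ≠ ρ₃) (d₂₃ : ρ₂ ≠ ρ₃)
    (hsign : f.eval α * f.eval β < 0)
    (hs₁ : α < s₁) (h₁₂ : s₁ < s₂) (hs₂ : s₂ < β) (e₁ : f.eval s₁ = 0) (e₂ : f.eval s₂ = 0) : False := by
  -- the two inside points differ from the three outside roots
  have ne₁ : ∀ ρ, (ρ < α ∨ β < ρ) → s₁ - ρ ≠ 0 := by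
    intro ρ h; rcases h with h | h
    · exact ne_of_gt (by linarith)
    · exact ne_of_lt (by linarith)
  have ne₂ : ∀ ρ, (ρ < α ∨ β < ρ) → s₂ - ρ ≠ 0 := by
    intro ρ h; rcases h with h | h
    · exact ne_of_gt (by linarith)
    · exact ne_of_lt (by linarith)
  -- split off ρ₁, ρ₂, ρ₃
  obtain ⟨g₁, hf₁, hg₁⟩ := exists_eq_X_sub_C_mul_of_eval_eq_zero f h₁
  have ev₁ : ∀ x, f.eval x = (x - ρ₁) * g₁.eval x := by
    intro x; rw [hf₁]; simp [eval_mul, eval_sub, eval_X, eval_C]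
  have r₂ : g₁.eval ρ₂ = 0 := by
    have h := h₂; rw [ev₁] at h
    rcases mul_eq_zero.mp h with h | h
    · exact absurd (sub_eq_zero.mp h) (Ne.symm d₁₂)
    · exact h
  obtain ⟨g₂, hf₂, hg₂⟩ := exists_eq_X_sub_C_mul_of_eval_eq_zero g₁ r₂
  have ev₂ : ∀ x, f.eval x = (x - ρ₁) * (x - ρ₂) * g₂.eval x := by
    intro x; rw [ev₁, hf₂]; simp [eval_mul, eval_sub, eval_X, eval_C]; ring
  have r₃ : g₂.eval ρ₃ = 0 := by
    have h := h₃; rw [ev₂] at h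
    rcases mul_eq_zero.mp h with h | h
    · rcases mul_eq_zero.mp h with h | h
      · exact absurd (sub_eq_zero.mp h) (Ne.symm d₁₃)
      · exact absurd (sub_eq_zero.mp h) (Ne.symm d₂₃)
    · exact h
  obtain ⟨g₃, hf₃, hg₃⟩ := exists_eq_X_sub_C_mul_of_eval_eq_zero g₂ r₃
  have ev₃ : ∀ x, f.eval x = (x - ρ₁) * (x - ρ₂) * (x - ρ₃) * g₃.eval x := by
    intro x; rw [ev₂, hf₃]; simp [eval_mul, eval_sub, eval_X, eval_C]; ring
  -- split off s₁, s₂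
  have q₁ : g₃.eval s₁ = 0 := by
    have h := e₁; rw [ev₃] at h
    have hne : (s₁ - ρ₁) * (s₁ - ρ₂) * (s₁ - ρ₃) ≠ 0 :=
      mul_ne_zero (mul_ne_zero (ne₁ ρ₁ o₁) (ne₁ ρ₂ o₂)) (ne₁ ρ₃ o₃)
    rcases mul_eq_zero.mp h with h | h
    · exact absurd h hne
    · exact h
  obtain ⟨g₄, hf₄, hg₄⟩ := exists_eq_X_sub_C_mul_of_eval_eq_zero g₃ q₁
  have ev₄ : ∀ x, f.eval x = (x - ρ₁) * (x - ρ₂) * (x - ρ₃) * (x - s₁) * g₄.eval x := by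
    intro x; rw [ev₃, hf₄]; simp [eval_mul, eval_sub, eval_X, eval_C]; ring
  have q₂ : g₄.eval s₂ = 0 := by
    have h := e₂; rw [ev₄] at h
    have hne : (s₂ - ρ₁) * (s₂ - ρ₂) * (s₂ - ρ₃) * (s₂ - s₁) ≠ 0 :=
      mul_ne_zero (mul_ne_zero (mul_ne_zero (ne₂ ρ₁ o₁) (ne₂ ρ₂ o₂)) (ne₂ ρ₃ o₃)) (ne_of_gt (by linarith))
    rcases mul_eq_zero.mp h with h | h
    · exact absurd h hne
    · exact h
  obtain ⟨g₅, hf₅, hg₅⟩ := exists_eq_X_sub_C_mul_of_eval_eq_zero g₄ q₂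
  -- the cofactor is a constant
  have hdeg : g₅.natDegree ≤ 0 := by omega
  have hconst : g₅ = C (g₅.coeff 0) := eq_C_of_natDegree_le_zero hdeg
  have ev₅ : ∀ x, f.eval x = (x - ρ₁) * (x - ρ₂) * (x - ρ₃) * (x - s₁) * (x - s₂) * g₅.coeff 0 := by
    intro x; rw [ev₄, hf₅, hconst]; simp [eval_mul, eval_sub, eval_X, eval_C]; ring
  -- the sign of the product at the two ends
  have hprod : f.eval α * f.eval β
      = ((α - ρ₁) * (β - ρ₁)) * ((α - ρ₂) * (β - ρ₂)) * ((α - ρ₃) * (β - ρ₃))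
        * (((α - s₁) * (β - s₁)) * ((α - s₂) * (β - s₂))) * (g₅.coeff 0) ^ 2 := by
    rw [ev₅, ev₅]; ring
  have p₁ := mul_sub_pos_of_outside hαβ o₁
  have p₂ := mul_sub_pos_of_outside hαβ o₂
  have p₃ := mul_sub_pos_of_outside hαβ o₃
  have n₁ : (α - s₁) * (β - s₁) < 0 := mul_neg_of_neg_of_pos (by linarith) (by linarith)
  have n₂ : (α - s₂) * (β - s₂) < 0 := mul_neg_of_neg_of_pos (by linarith) (by linarith)
  have p₄ : 0 < ((α - s₁) * (β - s₁)) * ((α - s₂) * (β - s₂)) := mul_pos_of_neg_of_neg n₁ n₂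
  have : 0 ≤ f.eval α * f.eval β := by
    rw [hprod]
    have := sq_nonneg (g₅.coeff 0)
    positivity
  linarith

/-! ## 2. The three quadratic brackets: roots, interlacing, one-sided signs -/

/-- **THE RIGHT WINDOW EDGE.**  `Qᵢ(T) = bⱼ(T+t₀)(tⱼ−T) − a(T+tⱼ)(T−t₀)` has exactly one positive root `Tₘ`, it lies in `(t₀, tⱼ)`, `Qᵢ > 0` on
`(0, Tₘ)`, `Qᵢ < 0` beyond `Tₘ`, and `Qᵢ′(Tₘ) < 0`; the right window of the critical windows law is `(Tₘ, tⱼ)`. [folklore] -/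
theorem rightEdge_exists {a bj t₀ tj : ℝ} (ha : 0 < a) (hbj : 0 < bj) (ht₀ : 0 < t₀) (h0j : t₀ < tj) :
    ∃ Tm : ℝ, t₀ < Tm ∧ Tm < tj ∧ (bj * (Tm + t₀) * (tj - Tm) - a * (Tm + tj) * (Tm - t₀)) = 0 ∧
      (∀ T : ℝ, 0 < T → T < Tm → 0 < (bj * (T + t₀) * (tj - T) - a * (T + tj) * (T - t₀))) ∧
      (∀ T : ℝ, Tm < T → (bj * (T + t₀) * (tj - T) - a * (T + tj) * (T - t₀)) < 0) ∧
      (bj * ((tj - Tm) - (Tm + t₀)) - a * ((Tm - t₀) + (Tm + tj))) < 0 := by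
  have hcont : ContinuousOn (fun T : ℝ => (bj * (T + t₀) * (tj - T) - a * (T + tj) * (T - t₀))) (Set.Icc t₀ tj) := by fun_prop
  have hlo : 0 < bj * (t₀ + t₀) * (tj - t₀) - a * (t₀ + tj) * (t₀ - t₀) := by
    have : 0 < bj * (t₀ + t₀) * (tj - t₀) := mul_pos (mul_pos hbj (by linarith)) (by linarith)
    nlinarith
  have hhi : bj * (tj + t₀) * (tj - tj) - a * (tj + tj) * (tj - t₀) < 0 := by
    have : 0 < a * (tj + tj) * (tj - t₀) := mul_pos (mul_pos ha (by linarith)) (by linarith)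
    nlinarith
  obtain ⟨Tm, ⟨h1, h2⟩, h0⟩ := intermediate_value_Ioo' (le_of_lt h0j) hcont ⟨hhi, hlo⟩
  simp only at h0
  have key : ∀ T : ℝ, Tm * (bj * (T + t₀) * (tj - T) - a * (T + tj) * (T - t₀)) = -(a + bj) * (T - Tm) * (T * Tm + t₀ * tj) := by
    intro T
    have e : Tm * (bj * (T + t₀) * (tj - T) - a * (T + tj) * (T - t₀)) - T * (bj * (Tm + t₀) * (tj - Tm) - a * (Tm + tj) * (Tm - t₀)) = -(a + bj) * (T - Tm) * (T * Tm + t₀ * tj) := by ring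
    rw [h0, mul_zero, sub_zero] at e
    exact e
  have hTm : 0 < Tm := by linarith
  have htj : 0 < tj := lt_trans ht₀ h0j
  refine ⟨Tm, h1, h2, h0, ?_, ?_, ?_⟩
  · intro T hT hlt
    have hk := key T
    have : 0 < -(a + bj) * (T - Tm) * (T * Tm + t₀ * tj) := by
      have h3 : 0 < (a + bj) * (Tm - T) := mul_pos (by linarith) (by linarith)
      have h4 : 0 < T * Tm + t₀ * tj := by positivity
      nlinarith
    rw [← hk] at this
    exact pos_of_mul_pos_right this hTm.le
  · intro T hT
    have hk := key T
    have hTpos : 0 < T := by linarith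
    have : -(a + bj) * (T - Tm) * (T * Tm + t₀ * tj) < 0 := by
      have h3 : 0 < (a + bj) * (T - Tm) := mul_pos (by linarith) (by linarith)
      have h4 : 0 < T * Tm + t₀ * tj := by positivity
      nlinarith
    rw [← hk] at this
    exact neg_of_mul_neg_right this hTm.le
  · -- Taylor at `Tₘ`, evaluated at `t₀`
    have tay : bj * (t₀ + t₀) * (tj - t₀) - a * (t₀ + tj) * (t₀ - t₀)
        = (bj * (Tm + t₀) * (tj - Tm) - a * (Tm + tj) * (Tm - t₀)) + (bj * ((tj - Tm) - (Tm + t₀)) - a * ((Tm - t₀) + (Tm + tj))) * (t₀ - Tm) - (a + bj) * (t₀ - Tm) ^ 2 := by ring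
    rw [h0, zero_add] at tay
    have hsq : 0 ≤ (a + bj) * (t₀ - Tm) ^ 2 := by positivity
    have : 0 < (bj * ((tj - Tm) - (Tm + t₀)) - a * ((Tm - t₀) + (Tm + tj))) * (t₀ - Tm) := by linarith
    have hneg : t₀ - Tm < 0 := by linarith
    nlinarith

/-- **THE LEFT WINDOW EDGE AND ITS MIRROR ROOT.**  `Qⱼ(T) = bᵢ(T+t₀)(T−tᵢ) + a(T+tᵢ)(T−t₀)` has a root `r₋ ∈ (−t₀, −tᵢ)` with `Qⱼ′(r₋) < 0` and
exactly one positive root `r₊ ∈ (tᵢ, t₀)` with `Qⱼ′(r₊) > 0`; `Qⱼ < 0` on `(0, r₊)` and `Qⱼ > 0` beyond `r₊`; the left window (letter `i` alone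
left of the pivot letter) is `(tᵢ, r₊)`. [folklore] -/
theorem leftEdge_exists {a bi t₀ ti : ℝ} (ha : 0 < a) (hbi : 0 < bi) (hti : 0 < ti) (hi0 : ti < t₀) :
    ∃ rm rp : ℝ, -t₀ < rm ∧ rm < -ti ∧ ti < rp ∧ rp < t₀ ∧ (bi * (rm + t₀) * (rm - ti) + a * (rm + ti) * (rm - t₀)) = 0 ∧ (bi * (rp + t₀) * (rp - ti) + a * (rp + ti) * (rp - t₀)) = 0 ∧
      (bi * ((rm - ti) + (rm + t₀)) + a * ((rm - t₀) + (rm + ti))) < 0 ∧ 0 < (bi * ((rp - ti) + (rp + t₀)) + a * ((rp - t₀) + (rp + ti))) ∧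
      (∀ T : ℝ, 0 < T → T < rp → (bi * (T + t₀) * (T - ti) + a * (T + ti) * (T - t₀)) < 0) ∧
      (∀ T : ℝ, rp < T → 0 < (bi * (T + t₀) * (T - ti) + a * (T + ti) * (T - t₀))) := by
  have hcont : ∀ u v : ℝ, ContinuousOn (fun T : ℝ => (bi * (T + t₀) * (T - ti) + a * (T + ti) * (T - t₀))) (Set.Icc u v) := by
    intro u v; fun_prop
  have v1 : 0 < bi * (-t₀ + t₀) * (-t₀ - ti) + a * (-t₀ + ti) * (-t₀ - t₀) := by
    have : 0 < a * (t₀ - ti) * (t₀ + t₀) := mul_pos (mul_pos ha (by linarith)) (by linarith)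
    nlinarith
  have v2 : bi * (-ti + t₀) * (-ti - ti) + a * (-ti + ti) * (-ti - t₀) < 0 := by
    have : 0 < bi * (t₀ - ti) * (ti + ti) := mul_pos (mul_pos hbi (by linarith)) (by linarith)
    nlinarith
  have v3 : bi * (ti + t₀) * (ti - ti) + a * (ti + ti) * (ti - t₀) < 0 := by
    have : 0 < a * (ti + ti) * (t₀ - ti) := mul_pos (mul_pos ha (by linarith)) (by linarith)
    nlinarith
  have v4 : 0 < bi * (t₀ + t₀) * (t₀ - ti) + a * (t₀ + ti) * (t₀ - t₀) := by
    have : 0 < bi * (t₀ + t₀) * (t₀ - ti) := mul_pos (mul_pos hbi (by linarith)) (by linarith)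
    nlinarith
  obtain ⟨rm, ⟨m1, m2⟩, m0⟩ := intermediate_value_Ioo' (by linarith : -t₀ ≤ -ti) (hcont _ _) ⟨v2, v1⟩
  obtain ⟨rp, ⟨p1, p2⟩, p0⟩ := intermediate_value_Ioo (le_of_lt hi0) (hcont _ _) ⟨v3, v4⟩
  simp only at m0 p0
  have key : ∀ T : ℝ, rp * (bi * (T + t₀) * (T - ti) + a * (T + ti) * (T - t₀)) = (a + bi) * (T - rp) * (T * rp + t₀ * ti) := by
    intro T
    have e : rp * (bi * (T + t₀) * (T - ti) + a * (T + ti) * (T - t₀)) - T * (bi * (rp + t₀) * (rp - ti) + a * (rp + ti) * (rp - t₀)) = (a + bi) * (T - rp) * (T * rp + t₀ * ti) := by ring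
    rw [p0, mul_zero, sub_zero] at e
    exact e
  have hrp : 0 < rp := by linarith
  have ht₀ : 0 < t₀ := by linarith
  refine ⟨rm, rp, m1, m2, p1, p2, m0, p0, ?_, ?_, ?_, ?_⟩
  · -- Taylor at `r₋`, evaluated at `−tᵢ`
    have tay : bi * (-ti + t₀) * (-ti - ti) + a * (-ti + ti) * (-ti - t₀)
        = (bi * (rm + t₀) * (rm - ti) + a * (rm + ti) * (rm - t₀)) + (bi * ((rm - ti) + (rm + t₀)) + a * ((rm - t₀) + (rm + ti))) * (-ti - rm) + (a + bi) * (-ti - rm) ^ 2 := by ring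
    rw [m0, zero_add] at tay
    have hsq : 0 ≤ (a + bi) * (-ti - rm) ^ 2 := by positivity
    have : (bi * ((rm - ti) + (rm + t₀)) + a * ((rm - t₀) + (rm + ti))) * (-ti - rm) < 0 := by linarith
    have hpos : 0 < -ti - rm := by linarith
    nlinarith
  · -- Taylor at `r₊`, evaluated at `tᵢ`
    have tay : bi * (ti + t₀) * (ti - ti) + a * (ti + ti) * (ti - t₀)
        = (bi * (rp + t₀) * (rp - ti) + a * (rp + ti) * (rp - t₀)) + (bi * ((rp - ti) + (rp + t₀)) + a * ((rp - t₀) + (rp + ti))) * (ti - rp) + (a + bi) * (ti - rp) ^ 2 := by ring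
    rw [p0, zero_add] at tay
    have hsq : 0 ≤ (a + bi) * (ti - rp) ^ 2 := by positivity
    have : (bi * ((rp - ti) + (rp + t₀)) + a * ((rp - t₀) + (rp + ti))) * (ti - rp) < 0 := by linarith
    have hneg : ti - rp < 0 := by linarith
    nlinarith
  · intro T hT hlt
    have hk := key T
    have : (a + bi) * (T - rp) * (T * rp + t₀ * ti) < 0 := by
      have h3 : (a + bi) * (T - rp) < 0 := mul_neg_of_pos_of_neg (by linarith) (by linarith)
      have h4 : 0 < T * rp + t₀ * ti := by positivity
      nlinarith
    rw [← hk] at this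
    exact neg_of_mul_neg_right this hrp.le
  · intro T hT
    have hk := key T
    have hTpos : 0 < T := by linarith
    have : 0 < (a + bi) * (T - rp) * (T * rp + t₀ * ti) := by
      have h3 : 0 < (a + bi) * (T - rp) := mul_pos (by linarith) (by linarith)
      have h4 : 0 < T * rp + t₀ * ti := by positivity
      nlinarith
    rw [← hk] at this
    exact pos_of_mul_pos_right this hrp.le

/-- **ONE-SIDED SIGNS OF THE BRACKETS.**  For `0 < tᵢ < t₀ < tⱼ` and positive rates: `Q₀ < 0` on `(tᵢ, tⱼ)`; `Q₀ > 0` on `(−tⱼ, −tᵢ)`;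
`Qᵢ > 0` on `(−t₀, t₀)`; `Qᵢ(tⱼ) < 0`; `Qⱼ(tᵢ) < 0`; `Qⱼ(tⱼ) > 0`. [folklore] -/
theorem bracket_signs {a bi bj t₀ ti tj : ℝ} (ha : 0 < a) (hbi : 0 < bi) (hbj : 0 < bj) (hti : 0 < ti) (hi0 : ti < t₀)
    (h0j : t₀ < tj) :
    (∀ T : ℝ, ti < T → T < tj → (bj * (T + ti) * (T - tj) - bi * (T + tj) * (T - ti)) < 0) ∧
    (∀ T : ℝ, -tj < T → T < -ti → 0 < (bj * (T + ti) * (T - tj) - bi * (T + tj) * (T - ti))) ∧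
    (∀ T : ℝ, -t₀ < T → T < t₀ → 0 < (bj * (T + t₀) * (tj - T) - a * (T + tj) * (T - t₀))) ∧
    (bj * (tj + t₀) * (tj - tj) - a * (tj + tj) * (tj - t₀)) < 0 ∧ (bi * (ti + t₀) * (ti - ti) + a * (ti + ti) * (ti - t₀)) < 0 ∧ 0 < (bi * (tj + t₀) * (tj - ti) + a * (tj + ti) * (tj - t₀)) := by
  refine ⟨?_, ?_, ?_, ?_, ?_, ?_⟩
  · intro T h1 h2
    have : bj * (T + ti) * (T - tj) < 0 := mul_neg_of_pos_of_neg (mul_pos hbj (by linarith)) (by linarith)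
    have : 0 < bi * (T + tj) * (T - ti) := mul_pos (mul_pos hbi (by linarith)) (by linarith)
    linarith
  · intro T h1 h2
    have : 0 < bj * (T + ti) * (T - tj) := mul_pos_of_neg_of_neg (mul_neg_of_pos_of_neg hbj (by linarith)) (by linarith)
    have : bi * (T + tj) * (T - ti) < 0 := mul_neg_of_pos_of_neg (mul_pos hbi (by linarith)) (by linarith)
    linarith
  · intro T h1 h2
    have : 0 < bj * (T + t₀) * (tj - T) := mul_pos (mul_pos hbj (by linarith)) (by linarith)
    have : a * (T + tj) * (T - t₀) < 0 := mul_neg_of_pos_of_neg (mul_pos ha (by linarith)) (by linarith)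
    linarith
  · have : 0 < a * (tj + tj) * (tj - t₀) := mul_pos (mul_pos ha (by linarith)) (by linarith)
    nlinarith
  · have : 0 < a * (ti + ti) * (t₀ - ti) := mul_pos (mul_pos ha (by linarith)) (by linarith)
    nlinarith
  · have : 0 < bi * (tj + t₀) * (tj - ti) := mul_pos (mul_pos hbi (by linarith)) (by linarith)
    have : 0 < a * (tj + ti) * (tj - t₀) := mul_pos (mul_pos ha (by linarith)) (by linarith)
    linarith

end Summit.ValiantsHypothesis.ValiantsHypothesis.Theorems.LacunarySymmetroidMatrixDescartes.Pivot.CriticalWindows.Three
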